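import Summits.HodgeConjecture.HodgeConjecture.Theorems.K2LiuCartanFamilySplit
import Summits.HodgeConjecture.HodgeConjecture.Theorems.K2LiuUnramifiedSectionOnCartan
import Summits.HodgeConjecture.HodgeConjecture.Theorems.K2LiuDoublingHeckeCartanSum
import Summits.HodgeConjecture.HodgeConjecture.Theorems.K2LiuGL2PrimitiveCosetCount
import Summits.HodgeConjecture.HodgeConjecture.Theorems.K2LiuCartanSeriesGL2Closed
import Summits.HodgeConjecture.HodgeConjecture.Theorems.K2LiuUnramifiedDoublingHeckePrelims
import Literature.NumberTheory.Automorphic.AdicCompletionResidueCard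
import Literature.NumberTheory.Automorphic.HeckeOperatorLocalFactor
import Literature.NumberTheory.Automorphic.HeckeOperatorAdjoint
import Literature.NumberTheory.Automorphic.EssConjSelfDual
import Literature.NumberTheory.GaloisRepresentations.HeckeLFunctionNonvanishingLineProofs

/-!
# The unramified doubling Hecke identity at a split good place, `n = 2` (socket #28s of hLiu418's LOCAL SEAM of s23)

Track B ∕ K2-LIT, hLiu418 = stmt-HodgeConjecture-24832; pays socket #28s `sig_K2LiuUnramifiedDoublingHeckeIdentity` of
`Cruxes/HLiu418/Lines/K2_Liu_CurveThetaSigs_U5b_LocalSeam.lean` (ED. 3 :130) BY NAME (`unramifiedDoublingHeckeIdentity`, statement verbatim).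
ASSEMBLY of ★ #26 `isCartanFamily_localInt_split` (`G_v = ⨆_a K_v t_a K_v` along `e_w : U(V)(L⁺_v) ≃ GL₂(L_w)`), ★ #27
`lambdaLoc_iotaLeftLocPi_diagonal_split` (`Λ_{s,v}(ι_v(t_a,1)) = χ_w^{M⁺}χ_{w̄}^{M⁻}q^{−(s+1)(M⁺+M⁻)}`), ★ H1 `isDoublingHeckeEigenvector_cLoc_of_isOpen`
(`T(Λ)u = (∑_a Λ(t_a)ev_a)u`), ★ F2 `heckeOperator_zpowDiagGL_apply_eq_smul` + `ncard_orbit_diag_le` (eigenvalues `e_k` and `#(K diag(ϖ^k,1)K∕K) ≤ 2q^k`,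
via ★ Tamagawa), ★ F3 `tsum_cartanSeriesGL2_mul_eq` (closed form), and the tree's Hecke dictionary ★ `heckeOperator_apply_eq_integral_holds`,
★ `heckeOperator_map_apply_eq_heckeOperator_comp_apply`, ★ `finite_orbit_map_and_ncard_eq`, ★ `measure_doubleCoset_eq_ncard_mul`.
[Li1992, §3 Thm. 3.1]; [GelbartPiatetskishapiroRallis1987, Part A §6]; [Liu2011, §2C (2-4)]; [HarrisKudlaSweet1996, §6 (6.12)–(6.13)]. Theorems only;
no `sorry`; axioms ⊆ {propext, Classical.choice, Quot.sound}. HONEST LABEL: HC_CM is proved only modulo the printed citations (2 remaining named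
inputs: hLiu418 = stmt-HodgeConjecture-24832, h413 = stmt-HodgeConjecture-24833) until rung 0 closes; this file pays one tier-1 socket and moves no counter.
-/

set_option autoImplicit false

set_option linter.dupNamespace false

noncomputable section

open scoped Matrix Pointwise
open NumberField IsDedekindDomain Matrix MeasureTheory MulAction ValuativeRel

namespace Summit.HodgeConjecture.HodgeConjecture.Cruxes.HLiu418.K2LiuUnramifiedDoublingHeckeIdentity

open Literature.NumberTheory.Automorphic Literature.NumberTheory.Automorphic.UnitaryGroup Literature.NumberTheory.GaloisRepresentations
open Literature.NumberTheory.GelbartRogawski1991 Literature.NumberTheory.GelbartRogawski1991.GRConstruction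
open Literature.NumberTheory.GelbartRogawski1991.UnitaryDualPair
open Literature.NumberTheory.K2Lit Literature.NumberTheory.K2Lit.SiegelDoubled
open Summit.HodgeConjecture.HodgeConjecture.Cruxes.HLiu418.K2LiuCartanFamilySplit
open Summit.HodgeConjecture.HodgeConjecture.Cruxes.HLiu418.K2LiuUnramifiedSectionOnCartan
open Summit.HodgeConjecture.HodgeConjecture.Cruxes.HLiu418.K2LiuDoublingHeckeCartanSum
open Summit.HodgeConjecture.HodgeConjecture.Cruxes.HLiu418.K2LiuGL2PrimitiveCosets
open Summit.HodgeConjecture.HodgeConjecture.Cruxes.HLiu418.K2LiuGL2HeckePrimitiveSplit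
open Summit.HodgeConjecture.HodgeConjecture.Cruxes.HLiu418.K2LiuGL2PrimitiveCosetCount
open Summit.HodgeConjecture.HodgeConjecture.Cruxes.HLiu418.K2LiuCartanSeriesGL2Closed
open Summit.HodgeConjecture.HodgeConjecture.Cruxes.HLiu418.K2LiuUnramifiedDoublingHeckePrelims

set_option maxHeartbeats 1600000 in -- the adelic unitary datum: `localPi`, `localInt`, `localPiSplitEquiv`, `LambdaLoc`, Cartan family
/-- **THE UNRAMIFIED DOUBLING HECKE IDENTITY AT A SPLIT GOOD PLACE, `n = 2`, GENERATOR INTERFACE, ORIENTATION `ε = +1`** — socket #28s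
`sig_K2LiuUnramifiedDoublingHeckeIdentity` verbatim: `u` is a doubling Hecke eigenvector of the kernel `Λ_{s,v}(ι_v(·,1))` (with convergence on
`Re s > 0`) with eigenvalue `c`, `c·Den₁·Den₂ = a₂·Num`, i.e. `c = L_v(s+½, BC(σ_v) ⊗ χ_v)∕b_{2,v}(s,χ)` in the generators. Proof: Cartan sum (★ H1)
over ★ #26's family, ★ #27's values of `Λ`, the `GL₂` Hecke eigenvalues ★ F2 transported along `e_w`, absolute convergence from ★ `ncard_orbit_diag_le`
and `summable_cartan_bound`, closed form ★ F3. [cite: Li1992, §3 Thm. 3.1] [cite: GelbartPiatetskishapiroRallis1987, Part A §6]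
[cite: Liu2011, §2C (2-4) p. 863] [cite: HarrisKudlaSweet1996, §6 (6.12)–(6.13)] [cite: Macdonald1971, Ch. V (1.2)] -/
theorem unramifiedDoublingHeckeIdentity :
    ∀ (L : Type) [Field L] [NumberField L] [IsCMField L] {n : ℕ} (e : Fin 2 × Fin 1 ≃ Fin n)
      (dV : Fin 2 → L) (hdV : ∀ i, IsCMField.complexConj L (dV i) = dV i) (_hdV0 : ∀ i, dV i ≠ 0)
      (dW : Fin 1 → L) (hdW : ∀ i, IsCMField.complexConj L (dW i) = dW i) (_hdW0 : ∀ i, dW i ≠ 0)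
      (v : HeightOneSpectrum (𝓞 (Fp L)))
      -- a SPLIT place of good reduction for `(V, χ)`
      (w : UnitaryGroup.PlacesOver L v) (_hw : IsCMField.complexConj L • w.1 ≠ w.1)
      (_h2 : ∀ w' : UnitaryGroup.PlacesOver L v, ValuativeRel.valuation (w'.1.adicCompletion L) (2 : w'.1.adicCompletion L) = 1)
      (_hdVw : ∀ (w' : UnitaryGroup.PlacesOver L v) (i : Fin 2),
        ValuativeRel.valuation (w'.1.adicCompletion L) (algebraMap L (w'.1.adicCompletion L) (dV i)) = 1)
      (_hT : ∀ (w' : UnitaryGroup.PlacesOver L v) (i j : Fin n), ValuativeRel.valuation (w'.1.adicCompletion L)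
        (algebraMap L (w'.1.adicCompletion L) (algebraMap (Fp L) L (gramR L e dV hdV dW hdW i j))) ≤ 1)
      (_hTinv : ∀ (w' : UnitaryGroup.PlacesOver L v) (i j : Fin n), ValuativeRel.valuation (w'.1.adicCompletion L)
        (algebraMap L (w'.1.adicCompletion L) (algebraMap (Fp L) L ((gramR L e dV hdV dW hdW)⁻¹ i j))) ≤ 1)
      (χ : HeckeCharacter L) (_hχu : χ.IsUnitary) (_hχ : ∀ w' : UnitaryGroup.PlacesOver L v, χ.IsUnramifiedAt w'.1)
      (s : ℂ) (_hs : 0 < s.re)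
      -- Haar measure on `G_v = U(V)(L⁺_v)` normalised by `ν(K_v) = 1`
      [MeasurableSpace (UnitaryGroup.localPi L (IsCMField.complexConj L) 2 (Matrix.diagonal dV) v)]
      [BorelSpace (UnitaryGroup.localPi L (IsCMField.complexConj L) 2 (Matrix.diagonal dV) v)]
      (ν : Measure (UnitaryGroup.localPi L (IsCMField.complexConj L) 2 (Matrix.diagonal dV) v)) [ν.IsHaarMeasure]
      (_hνK : ν (UnitaryGroup.localInt L (IsCMField.complexConj L) 2 (Matrix.diagonal dV) v :
          Set (UnitaryGroup.localPi L (IsCMField.complexConj L) 2 (Matrix.diagonal dV) v)) = 1)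
      -- the two Hecke generators, pinned by their `w`-components
      (t₁ t₂ : UnitaryGroup.localPi L (IsCMField.complexConj L) 2 (Matrix.diagonal dV) v)
      (_ht₁ : (((t₁ : UnitaryGroup.LocalGLPi L 2 v) w : GL (Fin 2) (w.1.adicCompletion L)) : Matrix (Fin 2) (Fin 2) (w.1.adicCompletion L)) =
        Matrix.diagonal ![(HeckeCharacter.uniformizer L w.1 : w.1.adicCompletion L), 1])
      (_ht₂ : (((t₂ : UnitaryGroup.LocalGLPi L 2 v) w : GL (Fin 2) (w.1.adicCompletion L)) : Matrix (Fin 2) (Fin 2) (w.1.adicCompletion L)) =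
        Matrix.diagonal ![(HeckeCharacter.uniformizer L w.1 : w.1.adicCompletion L), (HeckeCharacter.uniformizer L w.1 : w.1.adicCompletion L)])
      -- a contractive, strongly continuous Banach representation and a non-zero spherical Hecke eigenvector
      {V : Type} [NormedAddCommGroup V] [NormedSpace ℂ V] [CompleteSpace V]
      (τ : UnitaryGroup.localPi L (IsCMField.complexConj L) 2 (Matrix.diagonal dV) v →* (V →L[ℂ] V))
      (_hτc : ∀ x : V, Continuous fun g => τ g x) (_hτb : ∀ g, ‖τ g‖ ≤ 1)
      (u : V) (_hu : u ≠ 0) (a₁ a₂ : ℂ)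
      (_heig : IsSphericalHeckeEigen ν (UnitaryGroup.localInt L (IsCMField.complexConj L) 2 (Matrix.diagonal dV) v) ![t₁, t₂] (fun g => τ g) u ![a₁, a₂]),
      ∃ c : ℂ,
        IsDoublingHeckeEigenvector ν (fun g => LambdaLoc L e dV hdV dW hdW v χ s (iotaLeftLocPi L e dV hdV dW hdW v g)) (fun g => τ g) u c ∧
        c * ((1 - χ.valueAtUniformizer w.1 * a₁ * (w.1.residueCard : ℂ) ^ (-(s + 1)) +
                χ.valueAtUniformizer w.1 ^ 2 * a₂ * (w.1.residueCard : ℂ) ^ (-(2 * s + 1))) *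
              (a₂ - χ.valueAtUniformizer (UnitaryGroup.PlacesOver.galInv (IsCMField.complexConj L) w).1 * a₁ * (w.1.residueCard : ℂ) ^ (-(s + 1)) +
                χ.valueAtUniformizer (UnitaryGroup.PlacesOver.galInv (IsCMField.complexConj L) w).1 ^ 2 * (w.1.residueCard : ℂ) ^ (-(2 * s + 1)))) =
          a₂ * (1 - χ.valueAtUniformizer w.1 * χ.valueAtUniformizer (UnitaryGroup.PlacesOver.galInv (IsCMField.complexConj L) w).1 *
                  (w.1.residueCard : ℂ) ^ (-(2 * s + 2))) *
            (1 - χ.valueAtUniformizer w.1 * χ.valueAtUniformizer (UnitaryGroup.PlacesOver.galInv (IsCMField.complexConj L) w).1 *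
                  (w.1.residueCard : ℂ) ^ (-(2 * s + 1))) := by
  intro L _ _ _ n e dV hdV hdV0 dW hdW hdW0 v w hw h2 hdVw hT hTinv χ hχu hχ s hs _ _ ν _ hνK t₁ t₂ ht₁ ht₂ V _ _ _ τ hτc hτb u hu a₁ a₂ heig
  classical
  haveI : Algebra.IsQuadraticExtension (Fp L) L := IsCMField.isQuadraticExtension L
  set Kv := UnitaryGroup.localInt L (IsCMField.complexConj L) 2 (Matrix.diagonal dV) v with hKvdef
  /- ### the place data: uniformizer, residue cardinality -/
  have hϖv : Valued.v (HeckeCharacter.uniformizer L w.1 : w.1.adicCompletion L) = WithZero.exp (-1 : ℤ) :=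
    HeckeCharacter.valued_uniformizer (K := L) (v := w.1)
  have hϖU : IsUniformizingElement (HeckeCharacter.uniformizer L w.1 : w.1.adicCompletion L) := isUniformizingElement_of_valued_eq L w.1 hϖv
  have hϖ0 : (HeckeCharacter.uniformizer L w.1 : w.1.adicCompletion L) ≠ 0 := ne_zero_of_valued_eq L hϖv
  set q : ℕ := w.1.residueCard with hqdef
  have hqcard : Nat.card 𝓀[w.1.adicCompletion L] = q := by rw [hqdef, ← residueFieldCard_adicCompletion_eq]; rfl
  have hq1 : 1 < q := by rw [← hqcard]; exact Finite.one_lt_card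
  have hq0 : (q : ℂ) ≠ 0 := Nat.cast_ne_zero.2 (by omega)
  have hqpos : 0 < q := by omega
  have hnormϖ : ‖(HeckeCharacter.uniformizer L w.1 : w.1.adicCompletion L)‖ = (q : ℝ)⁻¹ := HeckeCharacter.norm_uniformizer w.1
  /- ### the split frame `e_w : G_v ≃ GL₂(L_w)` -/
  have hJi := unit_placeForm_diagonal_mem_glInt L dV hdV0 w.1 (hdVw w)
  set eW := UnitaryGroup.localPiSplitEquiv (IsCMField.complexConj L) (Matrix.diagonal dV) (IsCMField.complexConj_ne_one L)
    (transpose_map_diagonal L dV hdV) w hw (isUnit_placeForm_diagonal L dV hdV0 w.1) with heWdef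
  have hKi : ∀ g : GL (Fin 2) (w.1.adicCompletion L), eW.symm g ∈ Kv ↔ g ∈ glInt 2 (w.1.adicCompletion L) := fun g =>
    UnitaryGroup.localPiSplitEquiv_symm_mem_localInt_iff (IsCMField.complexConj L) (Matrix.diagonal dV) (IsCMField.complexConj_ne_one L)
      (transpose_map_diagonal L dV hdV) w hw (isUnit_placeForm_diagonal L dV hdV0 w.1) hJi g
  have hKe : ∀ g : UnitaryGroup.localPi L (IsCMField.complexConj L) 2 (Matrix.diagonal dV) v,
      eW g ∈ glInt 2 (w.1.adicCompletion L) ↔ g ∈ Kv := fun g => by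
    rw [← hKi, ContinuousMulEquiv.symm_apply_apply]
  have hKopen : IsOpen (Kv : Set (UnitaryGroup.localPi L (IsCMField.complexConj L) 2 (Matrix.diagonal dV) v)) :=
    UnitaryGroup.isOpen_localInt L (IsCMField.complexConj L) 2 (Matrix.diagonal dV) v
  have hKcpt : IsCompact (Kv : Set (UnitaryGroup.localPi L (IsCMField.complexConj L) 2 (Matrix.diagonal dV) v)) :=
    UnitaryGroup.isCompact_localInt L (IsCMField.complexConj L) 2 (Matrix.diagonal dV) v
  -- the generators in `GL₂(L_w)`: `e_w t₁ = D(1)`, `e_w t₂ = z`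
  set z : GL (Fin 2) (w.1.adicCompletion L) := zpowDiagGL hϖ0 (fun _ : Fin 2 => (1 : ℤ)) with hzdef
  have heWt₁ : eW t₁ = zpowDiagGL hϖ0 ![(1 : ℤ), 0] := by
    refine Units.ext ?_
    rw [heWdef, UnitaryGroup.localPiSplitEquiv_apply, ht₁, coe_zpowDiagGL]
    exact congrArg Matrix.diagonal (funext fun i => by fin_cases i <;> simp)
  have heWt₂ : eW t₂ = z := by
    refine Units.ext ?_
    rw [heWdef, UnitaryGroup.localPiSplitEquiv_apply, ht₂, hzdef, coe_zpowDiagGL]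
    exact congrArg Matrix.diagonal (funext fun i => by fin_cases i <;> simp)
  have ht₂z : t₂ = eW.symm z := by rw [← heWt₂, ContinuousMulEquiv.symm_apply_apply]
  have hzK : ∀ κ ∈ Kv, κ * t₂ = t₂ * κ := fun κ _ => by
    apply eW.injective
    rw [map_mul, map_mul, heWt₂, hzdef, ← zpowDiagGL_one_mul_comm hϖ0]
  /- ### the representation of `G_v` on `V` underlying `τ` and its transport to `GL₂(L_w)` -/
  set ρG : Representation ℂ (UnitaryGroup.localPi L (IsCMField.complexConj L) 2 (Matrix.diagonal dV) v) V :=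
    { toFun := fun g => ((τ g : V →L[ℂ] V) : V →ₗ[ℂ] V)
      map_one' := by rw [map_one]; rfl
      map_mul' := fun x y => by rw [map_mul]; rfl } with hρGdef
  have hρG : ∀ g x, ρG g x = τ g x := fun g x => rfl
  have hvK : u ∈ ρG.fixedPoints Kv := by rw [Representation.mem_fixedPoints]; exact heig.1
  set ρ' : Representation ℂ (GL (Fin 2) (w.1.adicCompletion L)) V := ρG.comp eW.symm.toMonoidHom with hρ'def
  have h1 : ∀ g ∈ glInt 2 (w.1.adicCompletion L), eW.symm.toMonoidHom g ∈ Kv := fun g hg => (hKi g).2 hg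
  have h2 : ∀ κ ∈ Kv,
      ∃ κ₁ ∈ Kv, ∃ g ∈ glInt 2 (w.1.adicCompletion L),
        κ = κ₁ * eW.symm.toMonoidHom g ∧ ∀ h : GL (Fin 2) (w.1.adicCompletion L), κ₁ * eW.symm.toMonoidHom h = eW.symm.toMonoidHom h * κ₁ :=
    fun κ hκ => ⟨1, one_mem _, eW κ, (hKe κ).2 hκ, by rw [one_mul]; exact (eW.symm_apply_apply κ).symm, fun h => by rw [one_mul, mul_one]⟩
  have h3 : ∀ g : GL (Fin 2) (w.1.adicCompletion L), eW.symm.toMonoidHom g ∈ Kv → g ∈ glInt 2 (w.1.adicCompletion L) :=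
    fun g hg => (hKi g).1 hg
  have hv' : u ∈ ρ'.fixedPoints (glInt 2 (w.1.adicCompletion L)) := mem_fixedPoints_comp_of_mem_fixedPoints ρG _ _ _ h1 hvK
  -- finiteness of the relevant `GL₂(𝒪_w)`-orbits
  have hfinD : ∀ k : ℕ, (orbit (glInt 2 (w.1.adicCompletion L))
      ((zpowDiagGL hϖ0 ![(k : ℤ), 0] : GL (Fin 2) (w.1.adicCompletion L)) : GL (Fin 2) (w.1.adicCompletion L) ⧸ glInt 2 (w.1.adicCompletion L))).Finite :=
    fun k => finite_orbit_diag hϖU k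
  have hzcomm : ∀ (j : ℤ), ∀ κ ∈ glInt 2 (w.1.adicCompletion L), κ * z ^ j = z ^ j * κ :=
    fun j κ hκ => ((show Commute κ z from glInt_mul_scalar_comm hϖ0 κ hκ).zpow_right j).eq
  have hfinzD : ∀ (j : ℤ) (k : ℕ), (orbit (glInt 2 (w.1.adicCompletion L))
      ((z ^ j * zpowDiagGL hϖ0 ![(k : ℤ), 0] : GL (Fin 2) (w.1.adicCompletion L)) : GL (Fin 2) (w.1.adicCompletion L) ⧸ glInt 2 (w.1.adicCompletion L))).Finite ∧
      (orbit (glInt 2 (w.1.adicCompletion L)) ((z ^ j * zpowDiagGL hϖ0 ![(k : ℤ), 0] : GL (Fin 2) (w.1.adicCompletion L)) :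
        GL (Fin 2) (w.1.adicCompletion L) ⧸ glInt 2 (w.1.adicCompletion L))).ncard ≤ 2 * q ^ k := by
    intro j k
    rw [orbit_mk_mul_eq_image _ (hzcomm j), Set.ncard_image_of_injective _ (MulAction.injective (z ^ j)), ← hqcard]
    exact ⟨(hfinD k).image _, ncard_orbit_diag_le hϖU k⟩
  have hfinz : (orbit (glInt 2 (w.1.adicCompletion L)) ((z : GL (Fin 2) (w.1.adicCompletion L)) :
      GL (Fin 2) (w.1.adicCompletion L) ⧸ glInt 2 (w.1.adicCompletion L))).Finite := by
    have h := (hfinzD 1 0).1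
    rwa [zpow_one, zpowDiagGL_zero_zero, mul_one] at h
  have htrans : ∀ g : GL (Fin 2) (w.1.adicCompletion L),
      (orbit (glInt 2 (w.1.adicCompletion L)) (g : GL (Fin 2) (w.1.adicCompletion L) ⧸ glInt 2 (w.1.adicCompletion L))).Finite →
      heckeOperator ρ' (glInt 2 (w.1.adicCompletion L)) g u =
        heckeOperator ρG Kv (eW.symm g) u := fun g hfin =>
    (heckeOperator_map_apply_eq_heckeOperator_comp_apply ρG eW.symm.toMonoidHom _ _ h1 h2 h3 g hfin hvK).symm
  /- ### Bochner ↔ algebraic Hecke operators, generator eigenvalues -/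
  have hbridge : ∀ g : UnitaryGroup.localPi L (IsCMField.complexConj L) 2 (Matrix.diagonal dV) v,
      ∫ x in DoubleCoset.doubleCoset g (Kv : Set _) Kv, τ x u ∂ν = heckeOperator ρG Kv g u := fun g => by
    have h := heckeOperator_apply_eq_integral_holds (V := V) ν Kv hKcpt hKopen ρG g hvK
    rw [hνK, ENNReal.toReal_one, inv_one, one_smul] at h
    exact h.symm
  have hgen₁ : heckeOperator ρG Kv t₁ u = a₁ • u := by
    have h := (heig.2 0).2
    simp only [Matrix.cons_val_zero] at h
    rw [← hbridge]
    exact h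
  have hgen₂ : heckeOperator ρG Kv t₂ u = a₂ • u := by
    have h := (heig.2 1).2
    simp only [Matrix.cons_val_one] at h
    rw [← hbridge]
    exact h
  have hT' : heckeOperator ρ' (glInt 2 (w.1.adicCompletion L)) (zpowDiagGL hϖU.ne_zero ![(1 : ℤ), 0]) u = a₁ • u := by
    rw [htrans _ (by exact_mod_cast hfinD 1), ← heWt₁, ContinuousMulEquiv.symm_apply_apply, hgen₁]
  have hZ' : heckeOperator ρ' (glInt 2 (w.1.adicCompletion L)) (zpowDiagGL hϖU.ne_zero (fun _ : Fin 2 => (1 : ℤ))) u = a₂ • u := by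
    rw [show zpowDiagGL hϖU.ne_zero (fun _ : Fin 2 => (1 : ℤ)) = z from rfl, htrans _ hfinz, ← ht₂z, hgen₂]
  /- ### the eigenvalues `e_k` of the primitive double cosets (★ F2) -/
  obtain ⟨ee, he0, he1, he2, herec⟩ : ∃ ee : ℕ → ℂ, ee 0 = 1 ∧ ee 1 = a₁ ∧ ee 2 = a₁ ^ 2 - ((q : ℂ) + 1) * a₂ ∧
      ∀ m, ee (m + 3) = a₁ * ee (m + 2) - (q : ℂ) * a₂ * ee (m + 1) :=
    ⟨fun m => (Nat.rec ((1 : ℂ), a₁, a₁ ^ 2 - ((q : ℂ) + 1) * a₂)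
        (fun _ p => (p.2.1, p.2.2, a₁ * p.2.2 - (q : ℂ) * a₂ * p.2.1)) m : ℂ × ℂ × ℂ).1, rfl, rfl, rfl, fun _ => rfl⟩
  have hek : ∀ k : ℕ, heckeOperator ρ' (glInt 2 (w.1.adicCompletion L)) (zpowDiagGL hϖ0 ![(k : ℤ), 0]) u = ee k • u := fun k =>
    heckeOperator_zpowDiagGL_apply_eq_smul hϖU ρ' hv' hT' hZ' ee he0 he1 (by rw [hqcard]; exact he2) (fun m => by rw [hqcard]; exact herec m) k
  /- ### `τ(t₂) u = a₂ u`, `a₂ ≠ 0`, powers of `t₂` -/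
  have hτz : τ t₂ u = a₂ • u := by
    rw [← hρG, ← heckeOperator_apply_of_comm ρG _ hzK hvK, hgen₂]
  obtain ⟨ha₂, hτzpow⟩ := apply_zpow_eq_smul τ hτz hu
  /- ### the Cartan family (★ #26) and its Hecke eigenvalues -/
  set t : {a : Fin 2 → ℤ // Antitone a} → UnitaryGroup.localPi L (IsCMField.complexConj L) 2 (Matrix.diagonal dV) v :=
    fun a => eW.symm (zpowDiagGL hϖ0 a.1) with htdef
  have hCartan : IsCartanFamily Kv t :=
    isCartanFamily_localInt_split L dV hdV hdV0 v w hw (hdVw w) hϖv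
  have hdecomp : ∀ a : {a : Fin 2 → ℤ // Antitone a},
      zpowDiagGL hϖ0 a.1 = z ^ (a.1 1) * zpowDiagGL hϖ0 ![(((a.1 0 - a.1 1).toNat : ℕ) : ℤ), 0] := by
    intro a
    have hk : (((a.1 0 - a.1 1).toNat : ℕ) : ℤ) = a.1 0 - a.1 1 := Int.toNat_of_nonneg (sub_nonneg.2 (a.2 (Fin.zero_le _)))
    have hzj : z ^ (a.1 1) = zpowDiagGL hϖ0 (fun _ : Fin 2 => a.1 1) := by
      rw [hzdef, zpowDiagGL, zpowDiagGL, ← map_zpow]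
      congr 1
      funext i
      simp
    rw [hzj, ← zpowDiagGL_add]
    congr 1
    funext i
    fin_cases i
    · simp [hk]
    · simp
  have ht_eq : ∀ a : {a : Fin 2 → ℤ // Antitone a},
      t a = t₂ ^ (a.1 1) * eW.symm (zpowDiagGL hϖ0 ![(((a.1 0 - a.1 1).toNat : ℕ) : ℤ), 0]) := fun a => by
    simp only [htdef]
    rw [hdecomp, map_mul, map_zpow, ← ht₂z]
  set ev : {a : Fin 2 → ℤ // Antitone a} → ℂ := fun a => a₂ ^ (a.1 1) * ee (a.1 0 - a.1 1).toNat with hevdef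
  have hm : ∀ g : UnitaryGroup.localPi L (IsCMField.complexConj L) 2 (Matrix.diagonal dV) v,
      MeasurableSet (DoubleCoset.doubleCoset g (Kv : Set _) Kv) := fun g => measurableSet_doubleCoset hKopen g
  have hint0 : ∀ g : UnitaryGroup.localPi L (IsCMField.complexConj L) 2 (Matrix.diagonal dV) v,
      IntegrableOn (fun x => τ x u) (DoubleCoset.doubleCoset g (Kv : Set _) Kv) ν := fun g =>
    (hτc u).continuousOn.integrableOn_compact ((hKcpt.mul isCompact_singleton).mul hKcpt)
  have hSph : IsSphericalHeckeEigen ν Kv t (fun g => τ g) u ev := by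
    refine ⟨heig.1, fun a => ⟨hint0 (t a), ?_⟩⟩
    show ∫ x in DoubleCoset.doubleCoset (t a) _ _, τ x u ∂ν = (a₂ ^ (a.1 1) * ee (a.1 0 - a.1 1).toNat) • u
    rw [ht_eq a]
    refine setIntegral_doubleCoset_mul_left_eq_smul ν hm (fun κ hκ => ((show Commute κ t₂ from hzK κ hκ).zpow_right (a.1 1)).eq) (τ := fun g => τ g)
      (fun y => by simp only [map_mul]; rfl) (hτzpow (a.1 1)) _ (hint0 _) ?_
    rw [hbridge, ← htrans _ (hfinD _), hek]
  /- ### the kernel `Λ_{s,v} ∘ ι_v(·,1)`: bi-invariance and values on the family (★ D7d, ★ #27) -/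
  have hΛ : ∀ x ∈ Kv,
      ∀ y ∈ Kv,
      ∀ g : UnitaryGroup.localPi L (IsCMField.complexConj L) 2 (Matrix.diagonal dV) v,
        (fun g => LambdaLoc L e dV hdV dW hdW v χ s (iotaLeftLocPi L e dV hdV dW hdW v g)) (x * g * y) =
          (fun g => LambdaLoc L e dV hdV dW hdW v χ s (iotaLeftLocPi L e dV hdV dW hdW v g)) g := fun x hx y hy g => by
    simp only
    rw [lambdaLoc_iotaLeft_mul_localInt L e dV hdV dW hdW v χ s hχ (x * g) hy, lambdaLoc_iotaLeft_localInt_mul L e dV hdV dW hdW v χ s hχ g hx]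
  have hn2 : n = 2 := by have h := Fintype.card_congr e; simpa using h.symm
  have hTw : ∀ i j, ValuativeRel.valuation (w.1.adicCompletion L)
      (LocalSplitting.gramW (Fp L) L v n (T₀ := gramR L e dV hdV dW hdW) w i j) ≤ 1 := fun i j => hT w i j
  have hTwd : ValuativeRel.valuation (w.1.adicCompletion L) (LocalSplitting.gramW (Fp L) L v n (T₀ := gramR L e dV hdV dW hdW) w).det = 1 := by
    have h := valuation_det_map_eq_one ((algebraMap L (w.1.adicCompletion L)).comp (algebraMap (Fp L) L))
      (isUnit_det_gramR₀ L e dV hdV hdV0 dW hdW hdW0) (fun i j => hT w i j) (fun i j => hTinv w i j)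
    rw [LocalSplitting.gramW, Matrix.map_map]
    exact h
  set A : ℂ := χ.valueAtUniformizer w.1 * (q : ℂ) ^ (-(s + 1)) with hAdef
  set B : ℂ := χ.valueAtUniformizer (UnitaryGroup.PlacesOver.galInv (IsCMField.complexConj L) w).1 * (q : ℂ) ^ (-(s + 1)) with hBdef
  have hΛt : ∀ a : {a : Fin 2 → ℤ // Antitone a},
      LambdaLoc L e dV hdV dW hdW v χ s (iotaLeftLocPi L e dV hdV dW hdW v (t a)) =
        A ^ ((a.1 0).toNat + (a.1 1).toNat) * B ^ ((-a.1 0).toNat + (-a.1 1).toNat) := by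
    intro a
    have h := lambdaLoc_iotaLeftLocPi_diagonal_split L e dV hdV dW hdW v χ s hχ hdV0 hdW0 w hw hTw hTwd hϖv a.1 (t a)
      (coe_cartanSplit_apply L dV hdV hdV0 v w hw hϖv a.1)
    rw [h, Fin.sum_univ_two, Fin.sum_univ_two, one_mul, one_mul, hn2, hnormϖ, show s + ((2 : ℕ) : ℂ) / 2 = s + 1 by push_cast; ring,
      ofReal_inv_pow_cpow hqpos, hAdef, hBdef, mul_pow, mul_pow, pow_add ((q : ℂ) ^ (-(s + 1)))]
    ring
  have hAnorm : ‖A‖ = (q : ℝ) ^ (-(s.re + 1)) := by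
    rw [hAdef, norm_mul, show ‖χ.valueAtUniformizer w.1‖ = 1 from hχu _, one_mul, Complex.norm_natCast_cpow_of_pos hqpos]
    simp
  have hBnorm : ‖B‖ = (q : ℝ) ^ (-(s.re + 1)) := by
    rw [hBdef, norm_mul, show ‖χ.valueAtUniformizer (UnitaryGroup.PlacesOver.galInv (IsCMField.complexConj L) w).1‖ = 1 from hχu _, one_mul,
      Complex.norm_natCast_cpow_of_pos hqpos]
    simp
  /- ### absolute convergence of the doubling Hecke operator on `u` -/
  set ρ₀ : ℝ := (q : ℝ) ^ (-(s.re + 1)) with hρ₀def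
  have hρ₀0 : 0 ≤ ρ₀ := Real.rpow_nonneg (Nat.cast_nonneg q) _
  have hq1r : (1 : ℝ) < q := by exact_mod_cast hq1
  have hqρ₀ : (q : ℝ) * ρ₀ < 1 := by
    have h : (q : ℝ) * ρ₀ = (q : ℝ) ^ (-s.re) := by
      rw [hρ₀def, show -(s.re + 1) = -s.re + (-1) by ring, Real.rpow_add (by positivity), Real.rpow_neg_one]
      field_simp
    rw [h]
    exact Real.rpow_lt_one_of_one_lt_of_neg hq1r (by linarith)
  set Λ' : UnitaryGroup.localPi L (IsCMField.complexConj L) 2 (Matrix.diagonal dV) v → ℂ :=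
    fun g => LambdaLoc L e dV hdV dW hdW v χ s (iotaLeftLocPi L e dV hdV dW hdW v g) with hΛ'def
  have hΛt' : ∀ a : {a : Fin 2 → ℤ // Antitone a}, Λ' (t a) = A ^ ((a.1 0).toNat + (a.1 1).toNat) * B ^ ((-a.1 0).toNat + (-a.1 1).toNat) :=
    fun a => hΛt a
  have hΛnorm : ∀ a : {a : Fin 2 → ℤ // Antitone a}, ‖Λ' (t a)‖ = ρ₀ ^ (((a.1 0).toNat + (a.1 1).toNat) + ((-a.1 0).toNat + (-a.1 1).toNat)) :=
    fun a => by rw [hΛt' a, norm_mul, norm_pow, norm_pow, hAnorm, hBnorm, ← pow_add]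
  -- `K_v = e_w⁻¹(GL₂(𝒪_w))` as subgroups, orbit sizes through `e_w`
  have hmapK : (glInt 2 (w.1.adicCompletion L)).map eW.symm.toMonoidHom = Kv := by
    ext g
    constructor
    · rintro ⟨g', hg', rfl⟩
      exact (hKi g').2 hg'
    · intro hg
      exact ⟨eW g, (hKe g).2 hg, eW.symm_apply_apply g⟩
  have horbG : ∀ a : {a : Fin 2 → ℤ // Antitone a},
      (orbit Kv
        (t a : UnitaryGroup.localPi L (IsCMField.complexConj L) 2 (Matrix.diagonal dV) v ⧸
          Kv)).Finite ∧
      (orbit Kv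
        (t a : UnitaryGroup.localPi L (IsCMField.complexConj L) 2 (Matrix.diagonal dV) v ⧸
          Kv)).ncard ≤ 2 * q ^ (a.1 0 - a.1 1).toNat := by
    intro a
    have hG := hfinzD (a.1 1) (a.1 0 - a.1 1).toNat
    rw [← hdecomp a] at hG
    have h := finite_orbit_map_and_ncard_eq eW.symm.toMonoidHom eW.symm.injective (glInt 2 (w.1.adicCompletion L)) (zpowDiagGL hϖ0 a.1) hG.1
    rw [hmapK] at h
    exact ⟨h.1, h.2 ▸ hG.2⟩
  have hvol : ∀ a : {a : Fin 2 → ℤ // Antitone a},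
      (ν (DoubleCoset.doubleCoset (t a) (Kv : Set _) Kv)).toReal ≤ 2 * (q : ℝ) ^ (a.1 0 - a.1 1).toNat := by
    intro a
    rw [measure_doubleCoset_eq_ncard_mul _ ν hKopen (t a) (horbG a).1, hνK, mul_one, ENNReal.toReal_natCast]
    exact_mod_cast (horbG a).2
  -- integrability on each double coset and the bound on the integral of the norm
  have hintS : ∀ a : {a : Fin 2 → ℤ // Antitone a}, IntegrableOn (fun x => Λ' x • τ x u)
      (DoubleCoset.doubleCoset (t a) (Kv : Set _) Kv) ν := fun a =>
    IntegrableOn.congr_fun (f := fun x => Λ' (t a) • τ x u) ((hint0 (t a)).smul (Λ' (t a)))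
      (fun x hx => by simp only [apply_eq_of_mem_doubleCoset hΛ hx]) (hm _)
  have hbnd : ∀ a : {a : Fin 2 → ℤ // Antitone a},
      ∫ x in DoubleCoset.doubleCoset (t a) (Kv : Set _) Kv, ‖Λ' x • τ x u‖ ∂ν ≤
      ‖u‖ * 2 * ((q : ℝ) ^ (a.1 0 - a.1 1).toNat * ρ₀ ^ (((a.1 0).toNat + (a.1 1).toNat) + ((-a.1 0).toNat + (-a.1 1).toNat))) := by
    intro a
    have hfin : ν (DoubleCoset.doubleCoset (t a) (Kv : Set _) Kv) < ⊤ :=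
      ((hKcpt.mul isCompact_singleton).mul hKcpt).measure_lt_top
    have hpt : ∀ x ∈ DoubleCoset.doubleCoset (t a) (Kv : Set _) Kv,
        ‖Λ' x • τ x u‖ ≤ ρ₀ ^ (((a.1 0).toNat + (a.1 1).toNat) + ((-a.1 0).toNat + (-a.1 1).toNat)) * ‖u‖ := by
      intro x hx
      rw [norm_smul, apply_eq_of_mem_doubleCoset hΛ hx, hΛnorm a]
      refine mul_le_mul_of_nonneg_left (((τ x).le_opNorm u).trans ?_) (pow_nonneg hρ₀0 _)
      calc ‖τ x‖ * ‖u‖ ≤ 1 * ‖u‖ := by gcongr; exact hτb x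
        _ = ‖u‖ := one_mul _
    calc ∫ x in DoubleCoset.doubleCoset (t a) (Kv : Set _) Kv, ‖Λ' x • τ x u‖ ∂ν
        ≤ ∫ x in DoubleCoset.doubleCoset (t a) (Kv : Set _) Kv,
            ρ₀ ^ (((a.1 0).toNat + (a.1 1).toNat) + ((-a.1 0).toNat + (-a.1 1).toNat)) * ‖u‖ ∂ν :=
          setIntegral_mono_on (hintS a).norm (integrableOn_const hfin.ne) (hm _) hpt
      _ = (ν (DoubleCoset.doubleCoset (t a) (Kv : Set _) Kv)).toReal *
            (ρ₀ ^ (((a.1 0).toNat + (a.1 1).toNat) + ((-a.1 0).toNat + (-a.1 1).toNat)) * ‖u‖) := by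
          rw [setIntegral_const, smul_eq_mul, Measure.real]
      _ ≤ 2 * (q : ℝ) ^ (a.1 0 - a.1 1).toNat * (ρ₀ ^ (((a.1 0).toNat + (a.1 1).toNat) + ((-a.1 0).toNat + (-a.1 1).toNat)) * ‖u‖) :=
          mul_le_mul_of_nonneg_right (hvol a) (mul_nonneg (pow_nonneg hρ₀0 _) (norm_nonneg u))
      _ = _ := by ring
  have hsum_bound : Summable fun a : {a : Fin 2 → ℤ // Antitone a} =>
      ∫ x in DoubleCoset.doubleCoset (t a) (Kv : Set _) Kv, ‖Λ' x • τ x u‖ ∂ν :=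
    Summable.of_nonneg_of_le (fun a => integral_nonneg fun x => norm_nonneg _) hbnd
      ((summable_cartan_bound hq1r.le hρ₀0 hqρ₀).mul_left (‖u‖ * 2))
  have hint : DoublingHeckeOpConverges ν Λ' (fun g => τ g) u := by
    have key := integrableOn_iUnion_of_summable_integral_norm (μ := ν) hintS hsum_bound
    rw [iUnion_doubleCoset_eq_univ hCartan, integrableOn_univ] at key
    exact key
  /- ### the eigen-equation (★ H1) and the closed form (★ F3) -/
  have hEig := isDoublingHeckeEigenvector_cLoc_of_isOpen ν hKopen hCartan hΛ hSph hint
  refine ⟨cLoc t Λ' ev, hEig, ?_⟩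
  have hsum : Summable fun a => Λ' (t a) * ev a := cLocSummable_of_ne_zero ν hCartan (fun a => hm (t a)) hΛ hSph hint hu
  obtain ⟨ε, hε, hεs⟩ := exists_antitoneEquiv
  set Gf : ℕ × ℤ → ℂ := fun p => Λ' (t (ε.symm p)) * ev (ε.symm p) with hGfdef
  have hGs : Summable Gf := ε.symm.summable_iff.2 hsum
  have hcG : cLoc t Λ' ev = ∑' p, Gf p := by
    rw [cLoc, hGfdef, ← ε.symm.tsum_eq]
  have hB0 : B ≠ 0 := by
    intro h0
    have h := hBnorm
    rw [h0, norm_zero] at h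
    exact (Real.rpow_pos_of_pos (by positivity) _).ne h
  have hGf : ∀ (k : ℕ) (j : ℤ), Gf (k, j) = ee k * a₂ ^ j * A ^ ((j + k).toNat + j.toNat) * B ^ ((-(j + k)).toNat + (-j).toNat) := by
    intro k j
    simp only [hGfdef, hΛt', hevdef, hεs, Fin.isValue, Matrix.cons_val_zero, Matrix.cons_val_one]
    rw [show (j + (k : ℤ) - j).toNat = k by omega, show (-(j + (k : ℤ))).toNat = (-(j + (k : ℤ))).toNat from rfl]
    ring
  have H := tsum_cartanSeriesGL2_mul_eq (A := A) ha₂ hB0 he0 he1 he2 herec hGf hGs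
  have hq2 : (q : ℂ) ^ (-(2 * s + 2)) = ((q : ℂ) ^ (-(s + 1))) ^ 2 := by
    rw [← Complex.cpow_nat_mul]; congr 1; push_cast; ring
  have hq3 : (q : ℂ) ^ (-(2 * s + 1)) = (q : ℂ) * ((q : ℂ) ^ (-(s + 1))) ^ 2 := by
    rw [← hq2, show -(2 * s + 1) = 1 + (-(2 * s + 2)) by ring, Complex.cpow_add _ _ hq0, Complex.cpow_one]
  rw [hcG, hq2, hq3]
  rw [hAdef, hBdef] at H
  linear_combination H

end Summit.HodgeConjecture.HodgeConjecture.Cruxes.HLiu418.K2LiuUnramifiedDoublingHeckeIdentity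

end
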